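import Literature.MathematicalPhysics.QuantumFieldTheory.Balaban1983to89.B6QGQCoerciveTowerTorus

/-!
# `Balaban1983to89.B8Ineq192FlatTorus` — T. Bałaban, *Spaces of regular gauge field configurations on a lattice and gauge
# fixing conditions*, Commun. Math. Phys. **99** (1985) 75–102 [Balaban1985RegularSpaces], **(1.92)** p. 91
# «|(H′X)(x)|, |(∇H′X)(x)| ≦ B′₀[1, (Lʲη)⁻¹]|X| for x ∈ Ω_j» (and the Δ-entry used on p. 93) for the operator (1.91)
# H′ = G′²Q′\*(Q′G′²Q′\*)⁻¹ **AT THE FLAT BACKGROUND U₀ = 1 ON THE ONE-SCALE TORUS, HYPOTHESIS-FREE** — the GENUINE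
# operators `G′_K = Δ′_a⁻¹`, `Q′_K*`, `(Q′_KG′_K²Q′_K*)⁻¹` of the tower-torus lineage, the inputs being the flat analogues of
# Theorems 3.1/3.2 of [4] that the tree holds with no hypothesis: [B6] Proposition 2.2, Proposition 2.3, Lemma 2.1 — and (v1.1, §5)
# the same for p. 92's «|Rf| ≦ B′₀|f|», R = I − G′Q′\*(Q′G′²Q′\*)⁻¹Q′G′ the projection (3.25) of [4] at U₀ = 1

statement-level skeleton of published theorems with citation tags; proofs where landed; nothing here is a claim about the Yang–Mills mass gap

PDF held: `paper:balaban1985-cmp99-regular-spaces-gauge-fixing` (journal page = PDF page + 74); p. 91 [PDF 17] read AS AN IMAGE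
(render `run/shared/lean/pub/pub-balaban/b2b-balaban-ref1/pages/1985-cmp99-regular-spaces-gauge-fixing-p017-x2.png`), pp. 92–93
[PDF 18–19] from the text layer and the cell's earlier image reads (modules `B8Ineq192Op`, `B8Eq191Hprime` of this seat).

CITATION HEADER (lean-in-tree rule).  Cell `lit-balaban` (HOME `run/shared/lean/pub/lit-balaban/`), unit `lit-balaban-r05` gen 16
(B8 reader/typer and fold owner; free-target protocol G.5-34(d), TAKING HOME/STATUS 2026-08-22T01:49Z).  WHAT IS REPRODUCED =
SKELETON row **B8.Eq1.91** ((1.91)–(1.92); head «typed-existing»: (1.92) is kernel-checked in `B8Ineq192` / `B8Ineq192Op` from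
Theorems 3.1–3.2 of [4] entered as HYPOTHESES of printed shape — the cell's interface need I-B8-2, bounds half), member (1.92):
this module proves (1.92), together with the un-displayed Δ-entry «ΔH′ ≲ (Lʲη)⁻²» that p. 93 l. 1–3 consumes (`B8Ineq192Op`
§2, a located reading), WITH NO HYPOTHESIS in the simplest geometry of the paper — the constant sequence of domains
Ω₀ = Ω₁ = ⋯ = Ω_k = T_η (p. 81: all blocks are unit-lattice blocks, ONE scale, `Lʲη = L^kη = 1`) at the flat background
U₀ = 1, scalar fibre — for the GENUINE operators of the tower-torus lineage of the cell: `G′ = G′_K = Δ′_a⁻¹ =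
(−Δ^η + m² + a_KQ′_K*Q′_K)⁻¹ = (B1RG242Torus.tower P a m²).G K` (`B6Prop22OneScaleTorus.gPrime_eq_deltaPrime_inv`), `Q′* =
B1RG242Torus.Qks P K` (block-constant extension), `(Q′G′²Q′*)⁻¹ = (B6QGGQInvTowerTorus.qggqK P a m²)⁻¹` («positive definite, so
its inverse is well defined», `B6QGGQInvTowerTorus.qggqK_isUnit`).  At U₀ = 1 the operators (1.91) ARE those of [B6] Sect. 2
(p. 235 «If we have one scale, i.e. Λ_k = T₁^{(k)}, then the operator is a unit lattice operator»; (2.98)–(2.101) p. 241), and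
the paper's sentence «They were investigated in [4], and the following inequality can be obtained from the results of this
paper» is realised with [4] ↦ its flat predecessor [B6], whose three results the tree holds HYPOTHESIS-FREE on this family:
Proposition 2.2 (2.67) (`B6Prop22OneScaleTorus.entries_oneScaleTorus`, p01/r03: the four sup entries `|G′λ|, |∇G′λ|, |G′∇*λ|,
|ΔG′λ| ≦ C e^{−½δ₀d(y,y′)}|λ|` for `supp λ ⊂ B(y′)`), Proposition 2.3 (2.87) (`B6QGQCoerciveTowerTorus.prop23Printed_towerTorus`,
p01 g6: `|(Q′G′²Q′*)⁻¹(y,y′)| ≦ C e^{−½δ₁d(y,y′)}`), Lemma 2.1 (2.61) in its torus row-sum form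
(`B6Lemma21TowerTorus.sum_exp_T1_le`: `Σ_{y′}e^{−αδ₀|y−y′|₁} ≦ c₀(α)^d`).  Kind «kernel-checked proof of a model instance»;
three definitions with bodies (`hPrimeK` = (1.91) and `rProjK` = [4] (3.25) on these carriers; the predicate `BlockBound` = the shape of a Prop.-2.2 entry); no `… : Prop` fact; 0 sorry; nothing of the tree is restated —
every input enters BY NAME.

WHAT IS PRINTED (verbatim).  p. 91 [PDF 17]: *"Let us introduce the operators H′ = G′²Q′\*(Q′G′²Q′\*)⁻¹, G′ = (Δ + Q′\*aQ′)⁻¹.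
(1.91) They were investigated in [4], and the following inequality can be obtained from the results of this paper: |(H′X)(x)|,
|(∇H′X)(x)| ≦ B′₀[1, (Lʲη)⁻¹]|X| for x ∈ Ω_j, (1.92)"*; p. 92 [PDF 18]: *"where (H′X)(x) = Σ_{y′∈𝔅_k}(L^{j′}η)^d H′(x, y′)X(y′),
and B′₀ is an absolute constant (depending on d and L only)."*; p. 93 [PDF 19] l. 1–3: *"… We get the same bound for the term
with D\*A (but with RD\*A subtracted), and with ΔH′D′(u₁, λ)."* (consumes a bound on ΔH′ of the shape (Lʲη)⁻², `B8Ineq192Op`);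
p. 96 [PDF 22], (1.115) ⇒ (1.116): the identity «Q′H′ = I».  [B6] = T. Bałaban, *Propagators and renormalization transformations
for lattice gauge theories. II*, CMP **96** (1984) 223–250 [Balaban1984PropagatorsII]: p. 235 [PDF 13] *"Of course the operator
Q′G′²Q′\* is positive definite, so its inverse is well defined. … If we have one scale, i.e. Λ_k = T₁^{(k)}, then the operator is a
unit lattice operator."*; Prop. 2.2 (2.67) p. 234, Prop. 2.3 (2.87) p. 238, Lemma 2.1 (2.61) p. 234 (verbatim in `B6.lean`).

WHAT THIS FILE PROVES (kernel; axioms standard).  `P : Params` a volume of the tower-torus lineage (fine torus `T_η = Site P 0`,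
η = ε = L^{−K}; unit torus `T₁^{(K)} = Site P K` = the block lattice 𝔅_k of the one-scale case; `K ≥ 1`), `a > 0`, `m² ≥ 0`.
* §1 **`hPrimeK P a m²`** := G′_K·G′_K·Q′_K*·(Q′_KG′_K²Q′_K*)⁻¹ — (1.91) with bodies on these carriers; **`qk_mul_hPrimeK`:
  Q′_KH′ = 1** («Q′H′ = I», p. 96); the kernel dictionary `hPrimeK_apply` (H′(x, y′) = (G′(G′(Q′*C⁻¹(·, y′))))(x)) and
  `qks_mul_apply` ((Q′*M)(z, y′) = M(y_z, y′), y_z the block of z).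
* §2 (engine, [B6] (2.52)–(2.55) with (2.61) on one scale) `BlockBound` (the shape of a Prop.-2.2 sup entry for one operator T:
  «supp λ ⊂ B(y′), |λ| ≦ S ⇒ |(Tλ)(x)| ≦ Ce^{−δd(y,y′)}S on B(y)»), **`decay_mulVec_of_blockBound`**: such a T maps a kernel column
  with |k(z)| ≦ Ae^{−ρd(y_z,y₀)} to one with |(Tk)(x)| ≦ CAc₀(ρ′)^d e^{−ρ′d(y_x,y₀)}, ρ′ = ½min(δ, ρ) (block decomposition, triangle
  inequality, torus row sum), and `abs_sum_mul_le_of_decay` (a decaying kernel row against a bounded coarse function).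
* §3 the inputs BY NAME: `blockBounds_of_prop22` ([B6] Prop. 2.2 ⇒ `BlockBound` for `G′_K`, `∂^η_μG′_K`, `(−Δ^η)G′_K` with one pair
  of constants on the whole family) and `cinv_decay_of_prop23` ([B6] Prop. 2.3 ⇒ `|(Q′G′²Q′*)⁻¹(y,y′)| ≦ C₁e^{−½δ₁|y−y′|₁}`).
* §4 **`hPrimeK_kernel_decay`**: there are `ρ, B > 0` depending on `d, L, a, m²` only such that on EVERY volume (`P.d = d`,
  `P.L = L`, every `m`, every `K ≥ 1`): `|H′(x,y′)|, |(∂^η_μH′)(x,y′)|, |((−Δ^η)H′)(x,y′)| ≦ B·e^{−ρ|y_x − y′|₁}` — the flat one-scale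
  form of «H′ ≺ κ_He^{−ρd}, ∇H′ ≺ …, ΔH′ ≺ …» of `B8Ineq192Op.ineq192_op`, now for genuine operators; **`ineq192_flat`** — **(1.92)
  AT U₀ = 1, ONE SCALE, NO HYPOTHESIS**: there is `B′₀ = B′₀(d, L, a, m²) > 0` such that on every volume, for every `X : 𝔅_k → ℝ`
  with `|X(y′)| ≦ S` and every fine point `x`: `|(H′X)(x)| ≦ B′₀S`, `|(∂^η_μH′X)(x)| ≦ B′₀S` (every direction μ; (Lʲη)⁻¹ = 1) and
  the p. 93 entry `|((−Δ^η)H′X)(x)| ≦ B′₀S` — uniformly in the mesh η = L^{−K} → 0 and in the volume; `ineq192_flat_supNorm` (the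
  same with `|X| = max_{y′}|X(y′)|`); `family_nonempty` (non-vacuity: members for every `m`, `K ≥ 1`).
* §5 (v1.1) **`rProjK P a m²`** := 1 − G′_KQ′_K*(Q′_KG′_K²Q′_K*)⁻¹Q′_KG′_K — the projection R of [4] (3.25) (= [B5] (1.44)) for the
  genuine one-scale operators, i.e. B8's `R(U₀)` (1.27) at U₀ = 1 and the constant domain sequence; `rProjK_mul_self` (R² = R),
  `qk_gPrime_mul_rProjK` (Q′G′R = 0: Ran R ⊂ Δ′_aN(Q′)), `rProjK_mulVec_deltaPrime_of_ker` («RΔλ = Δλ if Q′_kλ = 0», [B5] p. 25),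
  `rProjK_mul_gPrime_qks` (R·G′Q′* = 0); `sup_mulVec_of_blockBound` (|Tk| ≦ Cc₀^d|k|), `abs_qk_mulVec_le` (|Q′f| ≦ |f|),
  `gPrimeQksCinv_kernel_decay` (|(G′Q′*C⁻¹)(z, y′)| ≦ A₂e^{−ρ₂|y_z−y′|₁}); **`rProjK_sup_bound`** — B8 p. 92 «from Theorems 3.1, 3.2 of
  [4] it follows that |Rf| ≦ B′₀|f|» (row B8.Claim@92) AT U₀ = 1, ONE SCALE, WITH NO HYPOTHESIS: `|(Rf)(x)| ≦ B′₀|f|` on every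
  volume, `B′₀ = B′₀(d, L, a, m²)`.

HONEST SCOPE / NOT CLAIMED.  (i) ONE SCALE (the constant domain sequence; every prefactor `(Lʲη)^{±n} = 1`): the content is the
uniformity in η and the volume; the general (1.92) — arbitrary admissible {Ω_j}, a background U₀ ∈ 𝔄_k with (3.35) of [4] — stays
the typed leaf of `B8Ineq192`/`B8Ineq192Op` (interface need I-B8-2, bounds half; [4] Thms 3.1–3.3 are not in the tree as
theorems).  (ii) Scalar model (fibre ℝ, U₀ = 1), as in the whole tower-torus lineage; 𝔤-valued X follow componentwise but are not
spelled out.  (iii) The coarse weight `(L^{j′}η)^d` of p. 92's display equals 1 here (j′ = k); `|X|` = the sup norm over 𝔅_k; the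
torus distance is the periodic ℓ¹ distance `T1` of the lineage ([B6] p. 223 «|x − y| = Σ_μ|x_μ − y_μ|»); `m² ≥ 0` is carried by the
lineage's `G′` (the massless member m² = 0 is included) and `a > 0` is any ((1.91): the a of [3]).  (iv) Constants existential
(functions of `d, L, a, m²`; print: «B′₀ … depending on d and L only» at the series' fixed a, m² = 0), crude (rates halved at
each composition).  (v) Rows B8.Eq1.91 / B8.Claim@92: heads NOT changed by this file (owner's word: the general background is the [4]-leaf);
value = the first hypothesis-free instance of (1.92) in the tree, for genuine operators; NOT summit progress, NOT continuum, NOT Clay.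
(vi) No bridge to the other formalisations of (1.91)–(1.92) is asserted: `B8Eq191Hprime.HpL` lives on the ℓ²/(3.25)-data
carriers of `B9Thm311Lattice` and `B8Ineq192Op.ineq192_op` on the block-majorant letters of `B9Ineq368PPrime`; that at U₀ = 1,
one scale, those specialise to `hPrimeK` is the dictionary of the respective lineages and is not re-proved here.

RELATED IN THE TREE, NOT DUPLICATED (stem check 2026-08-22T01:49Z: `ls Balaban1983to89 | grep -i '192Flat\|192Torus'` = ∅):
`B8Ineq192` (kernel form modulo dictionary), `B8Ineq192Op` (operator form from [4]-shaped letters), `B8Ineq192GaugeInv` (gauge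
invariance of the shapes), `B8Eq191Hprime` ((1.91) with bodies on the ℓ²/(3.25)-data carriers, «Q′H′ = I» there),
`B6Hprime2132Torus` ([B6]'s Δ⁻²-variant H′_j of (2.101)/(2.132) by its momentum representation — a different operator),
`B6MainResultsOneLevel` (r03 g11: [B6] Prop 2.6/Cor 2.8 for H = GQ\*(QGQ\*)⁻¹ on one level — the operator H, not H′).
-/

noncomputable section

namespace Literature.MathematicalPhysics.QuantumFieldTheory.Balaban1983to89.B8Ineq192FlatTorus

open Finset Matrix
open B1RG242Torus (tower Qk Qks deriv hOp)
open B5Ineq137Torus (blk supN le_supN supN_nonneg)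
open B5GpSettingTorus (supNormV dir0)
open B5DictTorusEta (GpTopIdx)
open B6Prop22OneScaleTorus (T1 oneScaleGeo oneScaleGeo_len Index entryB entries_oneScaleTorus blockSup le_blockSup
  entryB_zero_top entryB_one_top entryB_three_top)
open B6Lemma21TowerTorus (T1_triangle T1_symm T1_nonneg sum_exp_T1_le)
open B6QGGQInvTowerTorus (qggqK mul_cinvK cinvK)
open B6QGQCoerciveTowerTorus (prop23Printed_towerTorus)

variable (P : Params)

/-! ## §1  (1.91) on the one-scale torus: `H′ = G′²Q′*(Q′G′²Q′*)⁻¹`, and «Q′H′ = I» -/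

/-- **(1.91) at U₀ = 1 on the one-scale torus**: `H′ = G′_K G′_K Q′_K* (Q′_KG′_K²Q′_K*)⁻¹ : (𝔅_k → ℝ) → (T_η → ℝ)` as a matrix
`T_η × T₁^{(K)}`, with the GENUINE `G′_K = Δ′_a⁻¹ = (tower P a m²).G K`, `Q′_K* = Qks P K` and `(Q′G′²Q′*)⁻¹ = (qggqK P a m²)⁻¹`
of the tower-torus lineage (at one scale the operators of (1.91) are [B6]'s unit-lattice operators, p. 235).
[cite: Balaban1985RegularSpaces, (1.91) p.91; Balaban1984PropagatorsII, p.235] -/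
def hPrimeK (a msq : ℝ) : Matrix (Site P 0) (Site P P.K) ℝ :=
  (tower P a msq).G P.K * (tower P a msq).G P.K * Qks P P.K * (qggqK P a msq)⁻¹

variable {P}

/-- **«Q′H′ = I»** (p. 96, the step (1.115) ⇒ (1.116)) for the one-scale torus H′: `Q′_K · H′ = 1` on `𝔅_k = T₁^{(K)}` — since
`Q′_K(G′G′Q′*)(Q′G′²Q′*)⁻¹ = (Q′G′²Q′*)(Q′G′²Q′*)⁻¹` and «the operator Q′G′²Q′\* is positive definite, so its inverse is well defined»
(`B6QGGQInvTowerTorus.mul_cinvK`). [cite: Balaban1985RegularSpaces, (1.115)–(1.116) p.96; Balaban1984PropagatorsII, p.235] -/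
theorem qk_mul_hPrimeK {a msq : ℝ} (ha : 0 < a) (hm : 0 ≤ msq) (hK : 1 ≤ P.K) :
    Qk P P.K * hPrimeK P a msq = 1 := by
  unfold hPrimeK
  rw [← mul_cinvK P ha hm hK]
  unfold qggqK
  simp only [Matrix.mul_assoc]

/-- hence `Q′_K(H′X) = X` for every coarse function `X`. [cite: Balaban1985RegularSpaces, (1.115)–(1.116) p.96] -/
theorem qk_mulVec_hPrimeK_mulVec {a msq : ℝ} (ha : 0 < a) (hm : 0 ≤ msq) (hK : 1 ≤ P.K) (X : Site P P.K → ℝ) :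
    Qk P P.K *ᵥ (hPrimeK P a msq *ᵥ X) = X := by
  rw [Matrix.mulVec_mulVec, qk_mul_hPrimeK ha hm hK, Matrix.one_mulVec]

/-- a matrix entry of a product is the action on a column (definitional). [folklore] -/
private theorem mul_apply_eq_mulVec {m n p : Type} [Fintype n] (M : Matrix m n ℝ) (N : Matrix n p ℝ) (x : m) (y : p) :
    (M * N) x y = (M *ᵥ fun z => N z y) x := rfl

/-- **`(Q′*M)(z, y′) = M(y_z, y′)`**, `y_z` the K-block of the fine point `z` (Q′\* = the block-constant extension,
`B1RG242Torus.Qks_mulVec`; `Site.proj K K = blk P K` definitionally). [cite: Balaban1985RegularSpaces, p.92 (the kernel H′(x, y′)); Balaban1982Higgs1, (1.5) p.604] -/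
theorem qks_mul_apply (a msq : ℝ) (M : Matrix (Site P P.K) (Site P P.K) ℝ) (z : Site P 0) (y' : Site P P.K) :
    (Qks P P.K * M) z y' = M (blk P P.K z) y' := by
  rw [mul_apply_eq_mulVec]
  exact B1RG242Torus.Qks_mulVec a msq (Nat.le_add_left P.K P.m) (fun y => M y y') z

/-- **The kernel of (1.91) as an iterated action** (p. 92: «(H′X)(x) = Σ_{y′} … H′(x, y′)X(y′)»): `H′(x, y′) = (G′k₂)(x)` with
`k₂ = G′k₁`, `k₁(z) = (Q′G′²Q′*)⁻¹(y_z, y′)` — the column of `Q′*(Q′G′²Q′*)⁻¹` at `y′`. [cite: Balaban1985RegularSpaces, (1.91) p.91, p.92] -/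
theorem hPrimeK_apply (a msq : ℝ) (x : Site P 0) (y' : Site P P.K) :
    hPrimeK P a msq x y' =
      ((tower P a msq).G P.K *ᵥ ((tower P a msq).G P.K *ᵥ fun z => (qggqK P a msq)⁻¹ (blk P P.K z) y')) x := by
  have hcol0 : (fun w => (Qks P P.K * (qggqK P a msq)⁻¹) w y') = fun w => (qggqK P a msq)⁻¹ (blk P P.K w) y' :=
    funext fun w => qks_mul_apply a msq _ w y'
  unfold hPrimeK
  rw [Matrix.mul_assoc, Matrix.mul_assoc, mul_apply_eq_mulVec]
  congr 2
  funext z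
  rw [mul_apply_eq_mulVec, hcol0]

/-- the same for a left factor: `(T·G′·G′·Q′*·C⁻¹)(x, y′) = (T(G′k₂…))(x)` written as `((T·G′)k₂)(x)`, `k₂ = G′k₁`.
[cite: Balaban1985RegularSpaces, (1.91)–(1.92) p.91] -/
theorem mul_hPrimeK_apply (a msq : ℝ) (T : Matrix (Site P 0) (Site P 0) ℝ) (x : Site P 0) (y' : Site P P.K) :
    (T * hPrimeK P a msq) x y' =
      ((T * (tower P a msq).G P.K) *ᵥ ((tower P a msq).G P.K *ᵥ fun z => (qggqK P a msq)⁻¹ (blk P P.K z) y')) x := by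
  have hcol0 : (fun w => (Qks P P.K * (qggqK P a msq)⁻¹) w y') = fun w => (qggqK P a msq)⁻¹ (blk P P.K w) y' :=
    funext fun w => qks_mul_apply a msq _ w y'
  unfold hPrimeK
  rw [show T * ((tower P a msq).G P.K * (tower P a msq).G P.K * Qks P P.K * (qggqK P a msq)⁻¹) =
      (T * (tower P a msq).G P.K) * ((tower P a msq).G P.K * (Qks P P.K * (qggqK P a msq)⁻¹)) by
    simp only [Matrix.mul_assoc], mul_apply_eq_mulVec]
  congr 2
  funext z
  rw [mul_apply_eq_mulVec, hcol0]

/-! ## §2  Engine: block decomposition + Prop.-2.2 block bound + torus row sum ([B6] (2.52)–(2.55), (2.61) on one scale) -/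

/-- a pointwise bound is a bound of the sup norm `|f|`. [folklore] -/
private theorem supN_le_of_forall {f : Site P 0 → ℝ} {S : ℝ} (h : ∀ z, |f z| ≤ S) : supN P f ≤ S :=
  Finset.sup'_le _ _ fun z _ => h z

/-- … and of the vector sup norm `|λ|` (1.108) of the constant family `ν ↦ f`. [folklore] -/
private theorem supNormV_const_le {f : Site P 0 → ℝ} {S : ℝ} (h : ∀ z, |f z| ≤ S) :
    supNormV P (fun _ : Fin P.d => f) ≤ S :=
  Finset.sup'_le _ _ fun _ _ => supN_le_of_forall h

/-- The shape of the Prop.-2.2 sup entries for ONE operator `T` on the fine torus, scalar test functions: for `λ` supported in the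
block `B(y′)` with `|λ| ≦ S`, `|(Tλ)(x)| ≦ C e^{−δd(y,y′)} S` at every point `x` of the block `B(y)`.
[cite: Balaban1984PropagatorsII, Prop. 2.2 (2.67) p.234] -/
def BlockBound (P : Params) (T : Matrix (Site P 0) (Site P 0) ℝ) (C δ : ℝ) : Prop :=
  ∀ (lam : Site P 0 → ℝ) (S : ℝ) (y y' : Site P P.K), 0 ≤ S → (∀ z, lam z ≠ 0 → blk P P.K z = y') → (∀ z, |lam z| ≤ S) →
    ∀ x, blk P P.K x = y → |(T *ᵥ lam) x| ≤ C * Real.exp (-(δ * T1 P P.K y y')) * S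

/-- product of two decaying exponentials along `y → y″ → y₀`, at the halved common rate: one factor carries the end-to-end distance
(triangle inequality (2.54)), the other the first leg (summable by (2.61)). [folklore] -/
private theorem exp_mul_exp_le {δ ρ d₁ d₂ d : ℝ} (hδ : 0 < δ) (hρ : 0 < ρ) (hd₁ : 0 ≤ d₁) (hd₂ : 0 ≤ d₂) (htri : d ≤ d₁ + d₂) :
    Real.exp (-(δ * d₁)) * Real.exp (-(ρ * d₂)) ≤
      Real.exp (-(min δ ρ / 2 * d)) * Real.exp (-(min δ ρ / 2 * d₁)) := by
  rw [← Real.exp_add, ← Real.exp_add]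
  apply Real.exp_le_exp.mpr
  have h1 : min δ ρ ≤ δ := min_le_left _ _
  have h2 : min δ ρ ≤ ρ := min_le_right _ _
  have h0 : 0 < min δ ρ := lt_min hδ hρ
  nlinarith [mul_nonneg h0.le hd₁, mul_nonneg h0.le hd₂, mul_le_mul_of_nonneg_right h1 hd₁,
    mul_le_mul_of_nonneg_right h2 hd₂]

/-- **Composition step** ([B6] (2.52)–(2.55) with (2.61), on one scale): if `T` has the Prop.-2.2 block bound with constants `C ≥ 0`,
`δ > 0`, and `k` is a column with `|k(z)| ≦ A e^{−ρ|y_z − y₀|₁}` (`A ≥ 0`, `ρ > 0`), then `|(Tk)(x)| ≦ C·A·c₀(ρ′)^d·e^{−ρ′|y_x − y₀|₁}`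
with `ρ′ = ½min(δ, ρ)`, `c₀(ρ′)^d` the torus row sum of Lemma 2.1: decompose `k = Σ_{y″} k·1_{B(y″)}`, bound each piece by the
block bound, and resum with the triangle inequality. [cite: Balaban1984PropagatorsII, (2.52)–(2.55) p.232, Lemma 2.1 (2.61) p.234] -/
theorem decay_mulVec_of_blockBound {T : Matrix (Site P 0) (Site P 0) ℝ} {C δ : ℝ} (hC : 0 ≤ C) (hδ : 0 < δ)
    (hT : BlockBound P T C δ) {k : Site P 0 → ℝ} {A ρ : ℝ} (hA : 0 ≤ A) (hρ : 0 < ρ) (y₀ : Site P P.K)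
    (hk : ∀ z, |k z| ≤ A * Real.exp (-(ρ * T1 P P.K (blk P P.K z) y₀))) (x : Site P 0) :
    |(T *ᵥ k) x| ≤ C * A * B6.c0 (min δ ρ / 2) 1 ^ P.d * Real.exp (-(min δ ρ / 2 * T1 P P.K (blk P P.K x) y₀)) := by
  set ρ' := min δ ρ / 2 with hρ'
  have hρ'0 : 0 < ρ' := by rw [hρ']; exact div_pos (lt_min hδ hρ) two_pos
  -- the block pieces of k
  set piece : Site P P.K → Site P 0 → ℝ := fun y'' z => if blk P P.K z = y'' then k z else 0 with hpiece
  have hdecomp : k = ∑ y'' : Site P P.K, piece y'' := by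
    funext z
    rw [Finset.sum_apply]
    simp only [hpiece]
    rw [Finset.sum_ite_eq Finset.univ (blk P P.K z) (fun _ => k z)]
    simp
  -- each piece: supported in its block, pointwise ≤ A e^{−ρ d(y″, y₀)}
  have hsupp : ∀ y'' z, piece y'' z ≠ 0 → blk P P.K z = y'' := by
    intro y'' z hz
    by_contra hne
    exact hz (by simp [hpiece, hne])
  have hbd : ∀ y'' z, |piece y'' z| ≤ A * Real.exp (-(ρ * T1 P P.K y'' y₀)) := by
    intro y'' z
    by_cases hz : blk P P.K z = y''
    · have := hk z
      rw [hz] at this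
      simpa [hpiece, hz] using this
    · simp only [hpiece, hz, if_false, abs_zero]
      exact mul_nonneg hA (Real.exp_nonneg _)
  -- the block bound on each piece, at the point x of the block y_x
  have hTp : ∀ y'', |(T *ᵥ piece y'') x| ≤
      C * Real.exp (-(δ * T1 P P.K (blk P P.K x) y'')) * (A * Real.exp (-(ρ * T1 P P.K y'' y₀))) :=
    fun y'' => hT (piece y'') _ (blk P P.K x) y'' (mul_nonneg hA (Real.exp_nonneg _)) (hsupp y'') (hbd y'') x rfl
  -- resummation
  have hrow := sum_exp_T1_le P P.K (δ₀ := ρ') (α := 1) (by rw [one_mul]; exact hρ'0) (blk P P.K x)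
  calc |(T *ᵥ k) x| = |∑ y'' : Site P P.K, (T *ᵥ piece y'') x| := by
        rw [hdecomp, Matrix.mulVec_sum, Finset.sum_apply]
    _ ≤ ∑ y'' : Site P P.K, |(T *ᵥ piece y'') x| := Finset.abs_sum_le_sum_abs _ _
    _ ≤ ∑ y'' : Site P P.K, C * Real.exp (-(δ * T1 P P.K (blk P P.K x) y'')) * (A * Real.exp (-(ρ * T1 P P.K y'' y₀))) :=
        Finset.sum_le_sum fun y'' _ => hTp y''
    _ = C * A * ∑ y'' : Site P P.K, Real.exp (-(δ * T1 P P.K (blk P P.K x) y'')) * Real.exp (-(ρ * T1 P P.K y'' y₀)) := by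
        rw [Finset.mul_sum]
        exact Finset.sum_congr rfl fun y'' _ => by ring
    _ ≤ C * A * ∑ y'' : Site P P.K, Real.exp (-(ρ' * T1 P P.K (blk P P.K x) y₀)) *
          Real.exp (-(ρ' * T1 P P.K (blk P P.K x) y'')) := by
        apply mul_le_mul_of_nonneg_left _ (mul_nonneg hC hA)
        exact Finset.sum_le_sum fun y'' _ =>
          exp_mul_exp_le hδ hρ (T1_nonneg P P.K _ _) (T1_nonneg P P.K _ _) (T1_triangle P P.K _ _ _)
    _ = C * A * Real.exp (-(ρ' * T1 P P.K (blk P P.K x) y₀)) *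
          ∑ y'' : Site P P.K, Real.exp (-(1 * ρ' * T1 P P.K (blk P P.K x) y'')) := by
        rw [← Finset.mul_sum, one_mul]; ring
    _ ≤ C * A * Real.exp (-(ρ' * T1 P P.K (blk P P.K x) y₀)) * B6.c0 ρ' 1 ^ P.d :=
        mul_le_mul_of_nonneg_left hrow (mul_nonneg (mul_nonneg hC hA) (Real.exp_nonneg _))
    _ = C * A * B6.c0 ρ' 1 ^ P.d * Real.exp (-(ρ' * T1 P P.K (blk P P.K x) y₀)) := by ring

/-- **Row sum of a decaying kernel against a bounded coarse function** ((2.61) once more): `|Σ_{y′}K(y′)X(y′)| ≦ B c₀(ρ)^d |X|`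
when `|K(y′)| ≦ Be^{−ρ|y − y′|₁}` and `|X(y′)| ≦ |X|`. [cite: Balaban1984PropagatorsII, Lemma 2.1 (2.61) p.234] -/
theorem abs_sum_mul_le_of_decay {Kr : Site P P.K → ℝ} {B ρ S : ℝ} (hB : 0 ≤ B) (hρ : 0 < ρ) (hS : 0 ≤ S) (y : Site P P.K)
    (hK : ∀ y', |Kr y'| ≤ B * Real.exp (-(ρ * T1 P P.K y y'))) {X : Site P P.K → ℝ} (hX : ∀ y', |X y'| ≤ S) :
    |∑ y', Kr y' * X y'| ≤ B * B6.c0 ρ 1 ^ P.d * S := by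
  have hrow := sum_exp_T1_le P P.K (δ₀ := ρ) (α := 1) (by rw [one_mul]; exact hρ) y
  calc |∑ y', Kr y' * X y'| ≤ ∑ y', |Kr y' * X y'| := Finset.abs_sum_le_sum_abs _ _
    _ ≤ ∑ y', B * Real.exp (-(ρ * T1 P P.K y y')) * S := Finset.sum_le_sum fun y' _ => by
        rw [abs_mul]
        exact mul_le_mul (hK y') (hX y') (abs_nonneg _) (mul_nonneg hB (Real.exp_nonneg _))
    _ = B * S * ∑ y', Real.exp (-(1 * ρ * T1 P P.K y y')) := by
        rw [Finset.mul_sum]; exact Finset.sum_congr rfl fun y' _ => by rw [one_mul]; ring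
    _ ≤ B * S * B6.c0 ρ 1 ^ P.d := mul_le_mul_of_nonneg_left hrow (mul_nonneg hB hS)
    _ = B * B6.c0 ρ 1 ^ P.d * S := by ring

/-- `c₀(ρ) = Σ_{z∈ℤ}e^{−ρ|z|} > 0` (its `z = 0` term is 1). [folklore] -/
private theorem c0_pos {ρ : ℝ} (hρ : 0 < ρ) : 0 < B6.c0 ρ 1 := by
  have hs := B6Lemma21Arith.summable_c0_term (show 0 < 1 * ρ by rw [one_mul]; exact hρ)
  have h1 : Real.exp (-(1 * ρ * |((0 : ℤ) : ℝ)|)) ≤ B6.c0 ρ 1 :=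
    hs.le_tsum 0 fun z _ => (Real.exp_pos _).le
  rw [Int.cast_zero, abs_zero, mul_zero, neg_zero, Real.exp_zero] at h1
  linarith

/-! ## §3  The inputs BY NAME: [B6] Prop. 2.2 (block bounds for `G′`, `∂_μG′`, `(−Δ^η)G′`) and Prop. 2.3 (`(Q′G′²Q′*)⁻¹`) -/

/-- **Proposition 2.2 of [B6] ⇒ the block bounds for `G′_K`, `∂^η_μG′_K` and `(−Δ^η)G′_K`**, uniformly on the one-scale torus
family: one pair `δ > 0`, `C > 0` (functions of `d, L, a, m²`) serving every volume `P` (`P.d = d`, `P.L = L`, `K ≥ 1`) — the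
sup entries n = 0, 1, 3 of (2.67) read for scalar test functions (`B6Prop22OneScaleTorus.entries_oneScaleTorus` with the constant
family `ν ↦ λ`, `entryB_zero_top`/`entryB_one_top`/`entryB_three_top`). [cite: Balaban1984PropagatorsII, Prop. 2.2 (2.67) p.234] -/
theorem blockBounds_of_prop22 (d L : ℕ) (hd : 1 ≤ d) (hL : Odd L ∧ 1 < L) {a : ℝ} (ha : 0 < a) {msq : ℝ} (hmsq : 0 ≤ msq) :
    ∃ δ C : ℝ, 0 < δ ∧ 0 < C ∧ ∀ t : GpTopIdx d L,
      BlockBound t.P ((tower t.P a msq).G t.P.K) C δ ∧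
      (∀ μ : Fin t.P.d, BlockBound t.P (deriv t.P 0 t.P.eps μ * (tower t.P a msq).G t.P.K) C δ) ∧
      BlockBound t.P (hOp t.P 0 t.P.eps 0 * (tower t.P a msq).G t.P.K) C δ := by
  obtain ⟨δ₀, C, Cα, hδ₀, hC, _, h⟩ := entries_oneScaleTorus d L hd hL ha hmsq
  refine ⟨δ₀ / 2, C, half_pos hδ₀, hC, fun t => ?_⟩
  -- the member of the family with these data (Mb, R are carried, unused)
  have hi := (h ⟨t, 0, 0⟩).1
  have key : ∀ (n : Fin 4) (lam : Site t.P 0 → ℝ) (S : ℝ) (y y' : Site t.P t.P.K),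
      (∀ z, lam z ≠ 0 → blk t.P t.P.K z = y') → (∀ z, |lam z| ≤ S) →
      entryB t.P a msq t.P.K n (fun _ : Fin t.P.d => lam) y ≤ C * Real.exp (-(δ₀ / 2 * T1 t.P t.P.K y y')) * S := by
    intro n lam S y y' hsupp hlam
    have h1 := hi n (fun _ : Fin t.P.d => lam) y y' (fun _ z hz => hsupp z hz)
    exact h1.trans (mul_le_mul_of_nonneg_left (supNormV_const_le hlam) (mul_nonneg hC.le (Real.exp_nonneg _)))
  refine ⟨fun lam S y y' _ hsupp hlam x hx => ?_, fun μ lam S y y' _ hsupp hlam x hx => ?_,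
    fun lam S y y' _ hsupp hlam x hx => ?_⟩
  · have hle : |((tower t.P a msq).G t.P.K *ᵥ lam) x| ≤ entryB t.P a msq t.P.K 0 (fun _ : Fin t.P.d => lam) y := by
      rw [entryB_zero_top]
      exact le_blockSup (dir0 t.P)
        (fun μ x => ((tower t.P a msq).G t.P.K *ᵥ (fun _ : Fin t.P.d => lam) μ) x) (dir0 t.P) hx
    exact hle.trans (key 0 lam S y y' hsupp hlam)
  · have hle : |((deriv t.P 0 t.P.eps μ * (tower t.P a msq).G t.P.K) *ᵥ lam) x| ≤
        entryB t.P a msq t.P.K 1 (fun _ : Fin t.P.d => lam) y := by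
      rw [entryB_one_top]
      exact le_blockSup (dir0 t.P, dir0 t.P)
        (fun p : Fin t.P.d × Fin t.P.d => fun x =>
          ((deriv t.P 0 t.P.eps p.1 * (tower t.P a msq).G t.P.K) *ᵥ (fun _ : Fin t.P.d => lam) p.2) x) (μ, dir0 t.P) hx
    exact hle.trans (key 1 lam S y y' hsupp hlam)
  · have hle : |((hOp t.P 0 t.P.eps 0 * (tower t.P a msq).G t.P.K) *ᵥ lam) x| ≤
        entryB t.P a msq t.P.K 3 (fun _ : Fin t.P.d => lam) y := by
      rw [entryB_three_top t.P ha hmsq t.hK]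
      exact le_blockSup (dir0 t.P)
        (fun μ x => ((hOp t.P 0 t.P.eps 0 * (tower t.P a msq).G t.P.K) *ᵥ (fun _ : Fin t.P.d => lam) μ) x) (dir0 t.P) hx
    exact hle.trans (key 3 lam S y y' hsupp hlam)

/-- **Proposition 2.3 of [B6] ⇒ the kernel bound for `(Q′_KG′_K²Q′_K*)⁻¹`**, uniformly on the one-scale torus family:
`|(Q′G′²Q′*)⁻¹(y, y′)| ≦ C₁e^{−½δ₁|y − y′|₁}` with one pair `δ₁, C₁ > 0` (functions of `d, L, a, m²`) for every volume — the verbatim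
census Prop `B6.Prop23Printed` (`B6QGQCoerciveTowerTorus.prop23Printed_towerTorus`, hypothesis-free) read on the member whose carried
big-block parameter `M` meets its threshold `M₁` (the kernel does not depend on it), prefactors `(Lʲη)⁻⁴(L^{j′}η)^{−d} = 1`.
[cite: Balaban1984PropagatorsII, Prop. 2.3 (2.87) p.238, p.235] -/
theorem cinv_decay_of_prop23 (d L : ℕ) (hd : 1 ≤ d) (hL : Odd L ∧ 1 < L) {a : ℝ} (ha : 0 < a) {msq : ℝ} (hmsq : 0 ≤ msq) :
    ∃ δ₁ C₁ : ℝ, 0 < δ₁ ∧ 0 < C₁ ∧ ∀ t : GpTopIdx d L, ∀ y y' : Site t.P t.P.K,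
      |(qggqK t.P a msq)⁻¹ y y'| ≤ C₁ * Real.exp (-(δ₁ / 2 * T1 t.P t.P.K y y')) := by
  obtain ⟨M₁, δ₁, C, _, hδ₁, hC, h⟩ := prop23Printed_towerTorus d L hd hL ha hmsq
  refine ⟨δ₁, C, hδ₁, hC, fun t y y' => ?_⟩
  have hi := h ⟨t, ⌈M₁⌉₊, 0⟩ trivial (Nat.le_ceil M₁) y y'
  simp only [oneScaleGeo_len, Real.one_rpow, mul_one] at hi
  exact hi

/-! ## §4  Kernel decay of `H′`, `∂_μH′`, `(−Δ^η)H′` and the inequality (1.92) at U₀ = 1, one scale -/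

/-- **KERNEL DECAY OF (1.91) AT U₀ = 1, ONE SCALE** (the flat one-scale form of «H′ ≺ κ_He^{−ρd}, ∇H′ ≺ κ_H(Lʲη)⁻¹e^{−ρd},
ΔH′ ≺ κ_H(Lʲη)⁻²e^{−ρd}» of `B8Ineq192Op.ineq192_op`, now for GENUINE operators and with NO hypothesis): there are `ρ > 0`, `B > 0`
depending on `d, L, a, m²` only such that on every volume of the family (`P.d = d`, `P.L = L`, every `m`, every `K ≥ 1`, mesh
η = L^{−K}), for every fine point `x` (in the block of `y_x`) and every `y′ ∈ 𝔅_k`: `|H′(x, y′)| ≦ Be^{−ρ|y_x − y′|₁}`,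
`|(∂^η_μH′)(x, y′)| ≦ Be^{−ρ|y_x − y′|₁}` (every μ), `|((−Δ^η)H′)(x, y′)| ≦ Be^{−ρ|y_x − y′|₁}`.  Mechanism = the paper's «obtained
from the results of [4]» at the flat background: Prop. 2.3 for the column of `Q′*(Q′G′²Q′*)⁻¹`, then Prop. 2.2 twice (inner `G′`,
outer `G′` / `∂_μG′` / `ΔG′`) through `decay_mulVec_of_blockBound`. [cite: Balaban1985RegularSpaces, (1.91)–(1.92) pp.91–92; Balaban1984PropagatorsII, Prop. 2.2 p.234, Prop. 2.3 p.238, Lemma 2.1 p.234] -/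
theorem hPrimeK_kernel_decay (d L : ℕ) (hd : 1 ≤ d) (hL : Odd L ∧ 1 < L) {a : ℝ} (ha : 0 < a) {msq : ℝ} (hmsq : 0 ≤ msq) :
    ∃ ρ B : ℝ, 0 < ρ ∧ 0 < B ∧ ∀ t : GpTopIdx d L, ∀ (x : Site t.P 0) (y' : Site t.P t.P.K),
      |hPrimeK t.P a msq x y'| ≤ B * Real.exp (-(ρ * T1 t.P t.P.K (blk t.P t.P.K x) y')) ∧
      (∀ μ : Fin t.P.d, |(deriv t.P 0 t.P.eps μ * hPrimeK t.P a msq) x y'| ≤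
        B * Real.exp (-(ρ * T1 t.P t.P.K (blk t.P t.P.K x) y'))) ∧
      |(hOp t.P 0 t.P.eps 0 * hPrimeK t.P a msq) x y'| ≤ B * Real.exp (-(ρ * T1 t.P t.P.K (blk t.P t.P.K x) y')) := by
  obtain ⟨δ, C, hδ, hC, hBB⟩ := blockBounds_of_prop22 d L hd hL ha hmsq
  obtain ⟨δ₁, C₁, hδ₁, hC₁, hCinv⟩ := cinv_decay_of_prop23 d L hd hL ha hmsq
  -- rates and constants of the two compositions (functions of d through c₀(·)^d)
  set ρ₂ := min δ (δ₁ / 2) / 2 with hρ₂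
  have hρ₂0 : 0 < ρ₂ := by rw [hρ₂]; exact div_pos (lt_min hδ (half_pos hδ₁)) two_pos
  set ρ₃ := min δ ρ₂ / 2 with hρ₃
  have hρ₃0 : 0 < ρ₃ := by rw [hρ₃]; exact div_pos (lt_min hδ hρ₂0) two_pos
  set A₂ := C * C₁ * B6.c0 ρ₂ 1 ^ d with hA₂
  set A₃ := C * A₂ * B6.c0 ρ₃ 1 ^ d with hA₃
  have hc0 : ∀ r : ℝ, 0 < r → 0 < B6.c0 r 1 := fun r hr => c0_pos hr
  have hA₂0 : 0 < A₂ := by rw [hA₂]; exact mul_pos (mul_pos hC hC₁) (pow_pos (hc0 ρ₂ hρ₂0) _)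
  have hA₃0 : 0 < A₃ := by rw [hA₃]; exact mul_pos (mul_pos hC hA₂0) (pow_pos (hc0 ρ₃ hρ₃0) _)
  refine ⟨ρ₃, A₃, hρ₃0, hA₃0, fun t x y' => ?_⟩
  obtain ⟨hG, hD, hLap⟩ := hBB t
  have hPd : t.P.d = d := t.hPd
  -- the column k₁ of Q′*(Q′G′²Q′*)⁻¹ at y′ and its image k₂ = G′k₁
  set k₁ : Site t.P 0 → ℝ := fun z => (qggqK t.P a msq)⁻¹ (blk t.P t.P.K z) y' with hk₁
  have hk₁b : ∀ z, |k₁ z| ≤ C₁ * Real.exp (-(δ₁ / 2 * T1 t.P t.P.K (blk t.P t.P.K z) y')) := fun z => hCinv t _ _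
  set k₂ : Site t.P 0 → ℝ := (tower t.P a msq).G t.P.K *ᵥ k₁ with hk₂
  have hk₂b : ∀ z, |k₂ z| ≤ A₂ * Real.exp (-(ρ₂ * T1 t.P t.P.K (blk t.P t.P.K z) y')) := by
    intro z
    have h := decay_mulVec_of_blockBound hC.le hδ hG hC₁.le (half_pos hδ₁) y' hk₁b z
    rw [hPd] at h
    exact h
  -- the outer factor, for each of the three operators
  have outer : ∀ {T : Matrix (Site t.P 0) (Site t.P 0) ℝ}, BlockBound t.P T C δ →
      |(T *ᵥ k₂) x| ≤ A₃ * Real.exp (-(ρ₃ * T1 t.P t.P.K (blk t.P t.P.K x) y')) := by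
    intro T hT
    have h := decay_mulVec_of_blockBound hC.le hδ hT hA₂0.le hρ₂0 y' hk₂b x
    rw [hPd] at h
    exact h
  refine ⟨?_, fun μ => ?_, ?_⟩
  · rw [hPrimeK_apply]; exact outer hG
  · rw [mul_hPrimeK_apply]; exact outer (hD μ)
  · rw [mul_hPrimeK_apply]; exact outer hLap

/-- **(1.92) AT U₀ = 1 ON THE ONE-SCALE TORUS, HYPOTHESIS-FREE** — «|(H′X)(x)|, |(∇H′X)(x)| ≦ B′₀[1, (Lʲη)⁻¹]|X| for x ∈ Ω_j»
with `Lʲη = 1` (one scale), plus the Δ-entry of p. 93: there is `B′₀ = B′₀(d, L, a, m²) > 0` such that on EVERY volume of the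
family (every `m`, every `K ≥ 1`: mesh η = L^{−K} arbitrarily small, volume arbitrarily large), for every coarse function
`X : 𝔅_k → ℝ` with `|X(y′)| ≦ S` and every fine point `x ∈ T_η`: `|(H′X)(x)| ≦ B′₀S`, `|(∂^η_μH′X)(x)| ≦ B′₀S` (every μ),
`|((−Δ^η)H′X)(x)| ≦ B′₀S` — for the genuine `H′ = G′²Q′*(Q′G′²Q′*)⁻¹` (`hPrimeK`).  From `hPrimeK_kernel_decay` and the torus row
sum (2.61) (`abs_sum_mul_le_of_decay`); print's «B′₀ is an absolute constant (depending on d and L only)» at the series' fixed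
`a`, `m² = 0`. [cite: Balaban1985RegularSpaces, (1.92) pp.91–92, p.93 l.1–3; Balaban1984PropagatorsII, Lemma 2.1 (2.61) p.234] -/
theorem ineq192_flat (d L : ℕ) (hd : 1 ≤ d) (hL : Odd L ∧ 1 < L) {a : ℝ} (ha : 0 < a) {msq : ℝ} (hmsq : 0 ≤ msq) :
    ∃ B₀' : ℝ, 0 < B₀' ∧ ∀ t : GpTopIdx d L, ∀ (X : Site t.P t.P.K → ℝ) (S : ℝ), 0 ≤ S → (∀ y', |X y'| ≤ S) →
      ∀ x : Site t.P 0,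
        |(hPrimeK t.P a msq *ᵥ X) x| ≤ B₀' * S ∧
        (∀ μ : Fin t.P.d, |((deriv t.P 0 t.P.eps μ * hPrimeK t.P a msq) *ᵥ X) x| ≤ B₀' * S) ∧
        |((hOp t.P 0 t.P.eps 0 * hPrimeK t.P a msq) *ᵥ X) x| ≤ B₀' * S := by
  obtain ⟨ρ, B, hρ, hB, h⟩ := hPrimeK_kernel_decay d L hd hL ha hmsq
  have hc0 : 0 < B6.c0 ρ 1 := c0_pos hρ
  refine ⟨B * B6.c0 ρ 1 ^ d, mul_pos hB (pow_pos hc0 _), fun t X S hS hX x => ?_⟩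
  have hPd : t.P.d = d := t.hPd
  have row : ∀ {Kr : Site t.P t.P.K → ℝ}, (∀ y', |Kr y'| ≤ B * Real.exp (-(ρ * T1 t.P t.P.K (blk t.P t.P.K x) y'))) →
      |∑ y', Kr y' * X y'| ≤ B * B6.c0 ρ 1 ^ d * S := by
    intro Kr hKr
    have h1 := abs_sum_mul_le_of_decay hB.le hρ hS (blk t.P t.P.K x) hKr hX
    rw [hPd] at h1
    exact h1
  refine ⟨row fun y' => (h t x y').1, fun μ => row fun y' => (h t x y').2.1 μ, row fun y' => (h t x y').2.2⟩

/-- **(1.92) at U₀ = 1, one scale, in the lineage's sup norm**: with `|X| := max_{y′}|X(y′)|`,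
`|(H′X)(x)|, |(∂^η_μH′X)(x)|, |((−Δ^η)H′X)(x)| ≦ B′₀|X|` on every volume. [cite: Balaban1985RegularSpaces, (1.92) pp.91–92] -/
theorem ineq192_flat_supNorm (d L : ℕ) (hd : 1 ≤ d) (hL : Odd L ∧ 1 < L) {a : ℝ} (ha : 0 < a) {msq : ℝ} (hmsq : 0 ≤ msq) :
    ∃ B₀' : ℝ, 0 < B₀' ∧ ∀ t : GpTopIdx d L, ∀ (X : Site t.P t.P.K → ℝ) (x : Site t.P 0),
        |(hPrimeK t.P a msq *ᵥ X) x| ≤ B₀' * Finset.univ.sup' Finset.univ_nonempty (fun y' => |X y'|) ∧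
        (∀ μ : Fin t.P.d, |((deriv t.P 0 t.P.eps μ * hPrimeK t.P a msq) *ᵥ X) x| ≤
          B₀' * Finset.univ.sup' Finset.univ_nonempty (fun y' => |X y'|)) ∧
        |((hOp t.P 0 t.P.eps 0 * hPrimeK t.P a msq) *ᵥ X) x| ≤
          B₀' * Finset.univ.sup' Finset.univ_nonempty (fun y' => |X y'|) := by
  obtain ⟨B₀', hB, h⟩ := ineq192_flat d L hd hL ha hmsq
  refine ⟨B₀', hB, fun t X x => h t X _ ?_ (fun y' => Finset.le_sup' (fun y' => |X y'|) (Finset.mem_univ y')) x⟩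
  exact le_trans (abs_nonneg _) (Finset.le_sup' (fun y' => |X y'|) (Finset.mem_univ (default : Site t.P t.P.K)))

/-- **Non-vacuity**: the family has a member for every volume exponent `m` and every `K ≥ 1` (mesh `L^{−K}`), for every `d ≥ 1` and odd
`L > 1`; so (1.92) above is asserted on arbitrarily fine and arbitrarily large tori. [cite: Balaban1985RegularSpaces, (1.92) p.91; Balaban1984PropagatorsII, p.235] -/
theorem family_nonempty (d L : ℕ) (hd : 1 ≤ d) (hL : Odd L ∧ 1 < L) (m K : ℕ) (hK : 1 ≤ K) :
    ∃ t : GpTopIdx d L, t.P.m = m ∧ t.P.K = K ∧ t.P.eps = ((L : ℝ)⁻¹) ^ K :=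
  ⟨⟨⟨d, L, m, K, hd, hL⟩, rfl, rfl, hK⟩, rfl, rfl, rfl⟩


/-! ## §5  The projection `R` of [4] (3.25) (= [B5] (1.44)) at U₀ = 1, one scale: «|Rf| ≦ B′₀|f|» (p. 92) with no hypothesis -/

variable (P) in
/-- **The gauge-fixing projection at U₀ = 1 on the one-scale torus**: `R = 1 − G′_KQ′_K*(Q′_KG′_K²Q′_K*)⁻¹Q′_KG′_K` — the formula
(3.25) of [4] «Rf = (I − G′Q′\*(Q′G′²Q′\*)⁻¹Q′G′)f» (= [B5] (1.44), the flat predecessor) for the GENUINE tower-torus operators; B8's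
`R(U₀)` of (1.27) at the flat background and the constant domain sequence. [cite: Balaban1985RegularSpaces, (1.27) p.80, p.92; Balaban1985BackgroundPropagators, (3.25) p.394; Balaban1984PropagatorsI, (1.44) p.25] -/
def rProjK (a msq : ℝ) : Matrix (Site P 0) (Site P 0) ℝ :=
  1 - (tower P a msq).G P.K * Qks P P.K * (qggqK P a msq)⁻¹ * (Qk P P.K * (tower P a msq).G P.K)

/-- `Q′_KG′_K · (G′_KQ′_K*(Q′G′²Q′*)⁻¹ · M) = M`: the letters `Q′G′` and `G′Q′*C⁻¹` cancel («Q′G′²Q′\* … its inverse is well defined»).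
[cite: Balaban1984PropagatorsII, p.235; Balaban1985BackgroundPropagators, (3.25) p.394] -/
theorem qkG_mul_GQksCinv_mul {a msq : ℝ} (ha : 0 < a) (hm : 0 ≤ msq) (hK : 1 ≤ P.K) {n : Type} (M : Matrix (Site P P.K) n ℝ) :
    Qk P P.K * (tower P a msq).G P.K * ((tower P a msq).G P.K * Qks P P.K * (qggqK P a msq)⁻¹ * M) = M := by
  calc Qk P P.K * (tower P a msq).G P.K * ((tower P a msq).G P.K * Qks P P.K * (qggqK P a msq)⁻¹ * M)
      = (Qk P P.K * (tower P a msq).G P.K * (tower P a msq).G P.K * Qks P P.K * (qggqK P a msq)⁻¹) * M := by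
        simp only [Matrix.mul_assoc]
    _ = (qggqK P a msq * (qggqK P a msq)⁻¹) * M := rfl
    _ = M := by rw [mul_cinvK P ha hm hK, Matrix.one_mul]

/-- **`R² = R`** (R is a projection; [4] p. 394 / [B5] p. 25 «The projection operator R»). [cite: Balaban1985BackgroundPropagators, (3.25) p.394; Balaban1984PropagatorsI, p.25] -/
theorem rProjK_mul_self {a msq : ℝ} (ha : 0 < a) (hm : 0 ≤ msq) (hK : 1 ≤ P.K) :
    rProjK P a msq * rProjK P a msq = rProjK P a msq := by
  set Pm := (tower P a msq).G P.K * Qks P P.K * (qggqK P a msq)⁻¹ * (Qk P P.K * (tower P a msq).G P.K) with hPm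
  have hPP : Pm * Pm = Pm := by
    calc Pm * Pm = (tower P a msq).G P.K * Qks P P.K * (qggqK P a msq)⁻¹ *
          (Qk P P.K * (tower P a msq).G P.K * ((tower P a msq).G P.K * Qks P P.K * (qggqK P a msq)⁻¹ *
            (Qk P P.K * (tower P a msq).G P.K))) := by
          simp only [hPm, Matrix.mul_assoc]
      _ = Pm := by rw [qkG_mul_GQksCinv_mul ha hm hK]
  unfold rProjK
  rw [← hPm, sub_mul, mul_sub, mul_sub, Matrix.one_mul, Matrix.mul_one, Matrix.one_mul, hPP, sub_self, sub_zero]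

/-- **`Q′_KG′_K·R = 0`**, i.e. `G′(Rf) ∈ N(Q′_K)` and so `Rf = Δ′_a(G′Rf) ∈ Δ′_aN(Q′_K)` for every `f`: Ran R lies in the subspace onto
which [B5] p. 25 / [4] (3.21)–(3.25) project («It is an orthogonal projection on the linear subspace ΔN(Q′_k) … N(Q′_k) = {λ : Q′_kλ = 0}»).
[cite: Balaban1984PropagatorsI, p.25; Balaban1985BackgroundPropagators, (3.21)–(3.25) p.394; Balaban1985RegularSpaces, (1.27) p.80] -/
theorem qk_gPrime_mul_rProjK {a msq : ℝ} (ha : 0 < a) (hm : 0 ≤ msq) (hK : 1 ≤ P.K) :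
    Qk P P.K * (tower P a msq).G P.K * rProjK P a msq = 0 := by
  unfold rProjK
  rw [Matrix.mul_sub, Matrix.mul_one, qkG_mul_GQksCinv_mul ha hm hK, sub_self]

/-- **`R(Δ′_aλ) = Δ′_aλ` for `λ ∈ N(Q′_K)`** («Indeed RΔλ = Δλ if Q′_kλ = 0», [B5] p. 25; `Δ′_a = B6QGGQInvTowerTorus.deltaPrimeK`,
`G′Δ′_a = 1`). [cite: Balaban1984PropagatorsI, p.25; Balaban1985BackgroundPropagators, (3.21)–(3.25) p.394] -/
theorem rProjK_mulVec_deltaPrime_of_ker {a msq : ℝ} (ha : 0 < a) (hm : 0 ≤ msq) (hK : 1 ≤ P.K) {lam : Site P 0 → ℝ}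
    (hlam : Qk P P.K *ᵥ lam = 0) :
    rProjK P a msq *ᵥ (B6QGGQInvTowerTorus.deltaPrimeK P a msq *ᵥ lam) = B6QGGQInvTowerTorus.deltaPrimeK P a msq *ᵥ lam := by
  unfold rProjK
  rw [Matrix.sub_mulVec, Matrix.one_mulVec, sub_eq_self, Matrix.mulVec_mulVec, Matrix.mul_assoc,
    Matrix.mul_assoc (Qk P P.K), B6QGGQInvTowerTorus.G_mul_deltaPrimeK P ha hm hK, Matrix.mul_one, ← Matrix.mulVec_mulVec,
    ← Matrix.mulVec_mulVec, hlam, Matrix.mulVec_zero, Matrix.mulVec_zero]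

/-- **`R(G′Q′*X) = 0`**: R annihilates `Ran(G′_KQ′_K*)` — the complement along which (3.22)'s minimiser is corrected
(`λ₀ = G′Rf = G′f − H′(Q′G′f)`-type identities of `B8Eq191Hprime.lam0_eq`, here for the genuine one-scale operators).
[cite: Balaban1985BackgroundPropagators, (3.22)–(3.25) p.394] -/
theorem rProjK_mul_gPrime_qks {a msq : ℝ} (ha : 0 < a) (hm : 0 ≤ msq) (hK : 1 ≤ P.K) :
    rProjK P a msq * ((tower P a msq).G P.K * Qks P P.K) = 0 := by
  have h := B6QGGQInvTowerTorus.cinvK_mul P ha hm hK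
  unfold rProjK
  rw [Matrix.sub_mul, Matrix.one_mul, sub_eq_zero]
  symm
  calc (tower P a msq).G P.K * Qks P P.K * (qggqK P a msq)⁻¹ * (Qk P P.K * (tower P a msq).G P.K) *
        ((tower P a msq).G P.K * Qks P P.K)
      = (tower P a msq).G P.K * Qks P P.K * ((qggqK P a msq)⁻¹ *
          (Qk P P.K * (tower P a msq).G P.K * (tower P a msq).G P.K * Qks P P.K)) := by
        simp only [Matrix.mul_assoc]
    _ = (tower P a msq).G P.K * Qks P P.K := by
        rw [show Qk P P.K * (tower P a msq).G P.K * (tower P a msq).G P.K * Qks P P.K = qggqK P a msq from rfl, h,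
          Matrix.mul_one]

/-- **Sup bound through a Prop.-2.2 block bound** ((2.61) once): if `T` has the block bound with `C ≥ 0`, `δ > 0` and `|k| ≦ S`, then
`|(Tk)(x)| ≦ C·c₀(δ)^d·S` — decompose `k` over the blocks and sum the row `Σ_{y″}e^{−δ|y_x − y″|₁} ≦ c₀(δ)^d`.
[cite: Balaban1984PropagatorsII, (2.52)–(2.55) p.232, Lemma 2.1 (2.61) p.234] -/
theorem sup_mulVec_of_blockBound {T : Matrix (Site P 0) (Site P 0) ℝ} {C δ : ℝ} (hC : 0 ≤ C) (hδ : 0 < δ)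
    (hT : BlockBound P T C δ) {k : Site P 0 → ℝ} {S : ℝ} (hS : 0 ≤ S) (hk : ∀ z, |k z| ≤ S) (x : Site P 0) :
    |(T *ᵥ k) x| ≤ C * B6.c0 δ 1 ^ P.d * S := by
  set piece : Site P P.K → Site P 0 → ℝ := fun y'' z => if blk P P.K z = y'' then k z else 0 with hpiece
  have hdecomp : k = ∑ y'' : Site P P.K, piece y'' := by
    funext z
    rw [Finset.sum_apply]
    simp only [hpiece]
    rw [Finset.sum_ite_eq Finset.univ (blk P P.K z) (fun _ => k z)]
    simp
  have hsupp : ∀ y'' z, piece y'' z ≠ 0 → blk P P.K z = y'' := by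
    intro y'' z hz
    by_contra hne
    exact hz (by simp [hpiece, hne])
  have hbd : ∀ y'' z, |piece y'' z| ≤ S := by
    intro y'' z
    by_cases hz : blk P P.K z = y''
    · simpa [hpiece, hz] using hk z
    · simp only [hpiece, hz, if_false, abs_zero]; exact hS
  have hTp : ∀ y'', |(T *ᵥ piece y'') x| ≤ C * Real.exp (-(δ * T1 P P.K (blk P P.K x) y'')) * S :=
    fun y'' => hT (piece y'') S (blk P P.K x) y'' hS (hsupp y'') (hbd y'') x rfl
  have hrow := sum_exp_T1_le P P.K (δ₀ := δ) (α := 1) (by rw [one_mul]; exact hδ) (blk P P.K x)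
  calc |(T *ᵥ k) x| = |∑ y'' : Site P P.K, (T *ᵥ piece y'') x| := by
        rw [hdecomp, Matrix.mulVec_sum, Finset.sum_apply]
    _ ≤ ∑ y'' : Site P P.K, |(T *ᵥ piece y'') x| := Finset.abs_sum_le_sum_abs _ _
    _ ≤ ∑ y'' : Site P P.K, C * Real.exp (-(δ * T1 P P.K (blk P P.K x) y'')) * S := Finset.sum_le_sum fun y'' _ => hTp y''
    _ = C * S * ∑ y'' : Site P P.K, Real.exp (-(1 * δ * T1 P P.K (blk P P.K x) y'')) := by
        rw [Finset.mul_sum]; exact Finset.sum_congr rfl fun y'' _ => by rw [one_mul]; ring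
    _ ≤ C * S * B6.c0 δ 1 ^ P.d := mul_le_mul_of_nonneg_left hrow (mul_nonneg hC hS)
    _ = C * B6.c0 δ 1 ^ P.d * S := by ring

/-- **`|Q′_Kf| ≦ |f|`**: the K-fold block average (2.11) `(Q′_Kf)(y) = L^{−Kd}Σ_{x∈B^K(y)}f(x)` does not increase the sup norm
(`B1RG242Torus.Qk_mulVec`, `|B^K(y)| = L^{Kd}`). [cite: Balaban1982Higgs1, (2.11) p.609; Balaban1984PropagatorsI, p.20 (Q′_k)] -/
theorem abs_qk_mulVec_le (a msq : ℝ) {f : Site P 0 → ℝ} {S : ℝ} (hf : ∀ z, |f z| ≤ S) (y : Site P P.K) :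
    |(Qk P P.K *ᵥ f) y| ≤ S := by
  have hK : P.K ≤ P.m + P.K := Nat.le_add_left _ _
  have hq := B1RG242Torus.Qk_mulVec a msq hK f y
  change (Qk P P.K *ᵥ f) y = _ at hq
  rw [hq, abs_mul, abs_of_nonneg (by positivity)]
  have hcard := B1RG242Torus.card_Bj (P := P) hK y
  have hL : (0 : ℝ) < P.L := by exact_mod_cast P.L_pos
  calc (((P.L : ℝ) ^ P.d)⁻¹) ^ P.K * |∑ x ∈ Finset.univ.filter (fun x : Site P 0 => Site.proj P.K P.K x = y), f x|
      ≤ (((P.L : ℝ) ^ P.d)⁻¹) ^ P.K * ∑ x ∈ Finset.univ.filter (fun x : Site P 0 => Site.proj P.K P.K x = y), |f x| :=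
        mul_le_mul_of_nonneg_left (Finset.abs_sum_le_sum_abs _ _) (by positivity)
    _ ≤ (((P.L : ℝ) ^ P.d)⁻¹) ^ P.K * ∑ _x ∈ Finset.univ.filter (fun x : Site P 0 => Site.proj P.K P.K x = y), S :=
        mul_le_mul_of_nonneg_left (Finset.sum_le_sum fun x _ => hf x) (by positivity)
    _ = (((P.L : ℝ) ^ P.d)⁻¹) ^ P.K * ((P.L ^ P.K) ^ P.d : ℕ) * S := by
        rw [Finset.sum_const, hcard, nsmul_eq_mul]; ring
    _ = S := by
        rw [Nat.cast_pow, Nat.cast_pow, inv_pow, ← pow_mul, ← pow_mul, mul_comm P.d P.K,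
          inv_mul_cancel₀ (pow_ne_zero _ hL.ne'), one_mul]

/-- **Kernel decay of `G′_KQ′_K*(Q′G′²Q′*)⁻¹`** (the three right letters of (1.91) / of (3.25)'s second term): there are `ρ₂, A₂ > 0`
(functions of `d, L, a, m²`) with `|(G′Q′*(Q′G′²Q′*)⁻¹)(z, y′)| ≦ A₂e^{−ρ₂|y_z − y′|₁}` on every volume — Prop. 2.3 for the column of
`Q′*(Q′G′²Q′*)⁻¹`, then Prop. 2.2 once. [cite: Balaban1985RegularSpaces, (1.91) p.91, p.92; Balaban1984PropagatorsII, Prop. 2.2 p.234, Prop. 2.3 p.238] -/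
theorem gPrimeQksCinv_kernel_decay (d L : ℕ) (hd : 1 ≤ d) (hL : Odd L ∧ 1 < L) {a : ℝ} (ha : 0 < a) {msq : ℝ}
    (hmsq : 0 ≤ msq) :
    ∃ ρ₂ A₂ : ℝ, 0 < ρ₂ ∧ 0 < A₂ ∧ ∀ t : GpTopIdx d L, ∀ (z : Site t.P 0) (y' : Site t.P t.P.K),
      |((tower t.P a msq).G t.P.K * Qks t.P t.P.K * (qggqK t.P a msq)⁻¹) z y'| ≤
        A₂ * Real.exp (-(ρ₂ * T1 t.P t.P.K (blk t.P t.P.K z) y')) := by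
  obtain ⟨δ, C, hδ, hC, hBB⟩ := blockBounds_of_prop22 d L hd hL ha hmsq
  obtain ⟨δ₁, C₁, hδ₁, hC₁, hCinv⟩ := cinv_decay_of_prop23 d L hd hL ha hmsq
  set ρ₂ := min δ (δ₁ / 2) / 2 with hρ₂
  have hρ₂0 : 0 < ρ₂ := by rw [hρ₂]; exact div_pos (lt_min hδ (half_pos hδ₁)) two_pos
  refine ⟨ρ₂, C * C₁ * B6.c0 ρ₂ 1 ^ d, hρ₂0, mul_pos (mul_pos hC hC₁) (pow_pos (c0_pos hρ₂0) _), fun t z y' => ?_⟩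
  obtain ⟨hG, -, -⟩ := hBB t
  have hk₁b : ∀ w : Site t.P 0, |(fun w => (qggqK t.P a msq)⁻¹ (blk t.P t.P.K w) y') w| ≤
      C₁ * Real.exp (-(δ₁ / 2 * T1 t.P t.P.K (blk t.P t.P.K w) y')) := fun w => hCinv t _ _
  have h := decay_mulVec_of_blockBound hC.le hδ hG hC₁.le (half_pos hδ₁) y' hk₁b z
  rw [t.hPd] at h
  have hcol0 : (fun w => (Qks t.P t.P.K * (qggqK t.P a msq)⁻¹) w y') =
      fun w => (qggqK t.P a msq)⁻¹ (blk t.P t.P.K w) y' := funext fun w => qks_mul_apply a msq _ w y'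
  rw [Matrix.mul_assoc, mul_apply_eq_mulVec, hcol0]
  exact h

/-- **«|Rf| ≦ B′₀|f|» (p. 92) AT U₀ = 1 ON THE ONE-SCALE TORUS, HYPOTHESIS-FREE** — B8 p. 92: «from Theorems 3.1, 3.2 of [4] it
follows that |Rf| ≦ B′₀|f|» (row B8.Claim@92; in the tree so far only from [4]-shaped letters, `B8Ineq198R.rf_sup_bound`): there is
`B′₀ = B′₀(d, L, a, m²) > 0` such that on EVERY volume of the family (every `m`, every `K ≥ 1`), for every fine function `f` with
`|f(z)| ≦ S`: `|(Rf)(x)| ≦ B′₀S` for the genuine `R = 1 − G′Q′*(Q′G′²Q′*)⁻¹Q′G′` (`rProjK`).  Chain: `|G′f| ≦ Cc₀^dS` (Prop. 2.2 +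
(2.61), `sup_mulVec_of_blockBound`), `|Q′G′f| ≦ |G′f|` (`abs_qk_mulVec_le`), the decaying kernel of `G′Q′*(Q′G′²Q′*)⁻¹`
(`gPrimeQksCinv_kernel_decay`) summed against it ((2.61), `abs_sum_mul_le_of_decay`). [cite: Balaban1985RegularSpaces, p.92; Balaban1985BackgroundPropagators, Thm 3.1 (3.42) p.397, Thm 3.2 (3.48) p.398, (3.25) p.394; Balaban1984PropagatorsII, Prop. 2.2 p.234, Prop. 2.3 p.238, Lemma 2.1 (2.61) p.234] -/
theorem rProjK_sup_bound (d L : ℕ) (hd : 1 ≤ d) (hL : Odd L ∧ 1 < L) {a : ℝ} (ha : 0 < a) {msq : ℝ} (hmsq : 0 ≤ msq) :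
    ∃ B₀' : ℝ, 0 < B₀' ∧ ∀ t : GpTopIdx d L, ∀ (f : Site t.P 0 → ℝ) (S : ℝ), 0 ≤ S → (∀ z, |f z| ≤ S) →
      ∀ x : Site t.P 0, |(rProjK t.P a msq *ᵥ f) x| ≤ B₀' * S := by
  obtain ⟨δ, C, hδ, hC, hBB⟩ := blockBounds_of_prop22 d L hd hL ha hmsq
  obtain ⟨ρ₂, A₂, hρ₂, hA₂, hKer⟩ := gPrimeQksCinv_kernel_decay d L hd hL ha hmsq
  have hc0δ : 0 < B6.c0 δ 1 := c0_pos hδ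
  have hc0ρ : 0 < B6.c0 ρ₂ 1 := c0_pos hρ₂
  refine ⟨1 + A₂ * B6.c0 ρ₂ 1 ^ d * (C * B6.c0 δ 1 ^ d), by positivity, fun t f S hS hf x => ?_⟩
  obtain ⟨hG, -, -⟩ := hBB t
  have hPd : t.P.d = d := t.hPd
  -- |G′f| ≤ C c₀(δ)^d S, hence |Q′G′f| ≤ the same
  have hGf : ∀ z, |((tower t.P a msq).G t.P.K *ᵥ f) z| ≤ C * B6.c0 δ 1 ^ d * S := by
    intro z
    have h := sup_mulVec_of_blockBound hC.le hδ hG hS hf z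
    rw [hPd] at h
    exact h
  have hX : ∀ y, |(Qk t.P t.P.K *ᵥ ((tower t.P a msq).G t.P.K *ᵥ f)) y| ≤ C * B6.c0 δ 1 ^ d * S :=
    fun y => abs_qk_mulVec_le a msq hGf y
  -- the second term of R
  have hS₁ : 0 ≤ C * B6.c0 δ 1 ^ d * S := by positivity
  have h2 : |(((tower t.P a msq).G t.P.K * Qks t.P t.P.K * (qggqK t.P a msq)⁻¹) *ᵥ
      (Qk t.P t.P.K *ᵥ ((tower t.P a msq).G t.P.K *ᵥ f))) x| ≤ A₂ * B6.c0 ρ₂ 1 ^ d * (C * B6.c0 δ 1 ^ d * S) := by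
    have h := abs_sum_mul_le_of_decay hA₂.le hρ₂ hS₁ (blk t.P t.P.K x) (fun y' => hKer t x y') hX
    rw [hPd] at h
    exact h
  -- R f = f − (G′Q′*C⁻¹)(Q′(G′f))
  have hR : (rProjK t.P a msq *ᵥ f) x =
      f x - (((tower t.P a msq).G t.P.K * Qks t.P t.P.K * (qggqK t.P a msq)⁻¹) *ᵥ
        (Qk t.P t.P.K *ᵥ ((tower t.P a msq).G t.P.K *ᵥ f))) x := by
    unfold rProjK
    simp only [Matrix.sub_mulVec, Matrix.one_mulVec, Matrix.mulVec_mulVec, Matrix.mul_assoc, Pi.sub_apply]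
  rw [hR]
  calc |f x - _| ≤ |f x| + |(((tower t.P a msq).G t.P.K * Qks t.P t.P.K * (qggqK t.P a msq)⁻¹) *ᵥ
        (Qk t.P t.P.K *ᵥ ((tower t.P a msq).G t.P.K *ᵥ f))) x| := abs_sub _ _
    _ ≤ S + A₂ * B6.c0 ρ₂ 1 ^ d * (C * B6.c0 δ 1 ^ d * S) := add_le_add (hf x) h2
    _ = (1 + A₂ * B6.c0 ρ₂ 1 ^ d * (C * B6.c0 δ 1 ^ d)) * S := by ring

end Literature.MathematicalPhysics.QuantumFieldTheory.Balaban1983to89.B8Ineq192FlatTorus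

end
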